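import Literature.Geometry.Lorentzian.RicciVariationMassDerivative
import Literature.Geometry.Lorentzian.ConformalScalarFlatCore
import Literature.Geometry.Lorentzian.AFConformalPositivity
import HarnessLib

/-!
# Lemma 3.3 along `ds²_t = ds² + t Ric` from the existence of the conformal factor
# (Schoen–Yau 1979, pp. 72–73): step `hc` of positive mass rigidity reduced to Lemma 3.2

Schoen–Yau, Comm. Math. Phys. 65 (1979), p. 73: *"For `t` sufficiently small, `ds²_t` is
asymptotically flat by (1.2), and `(∫_N |R_t|^{3/2} √g_t dx)^{2/3} < ε₀` … Thus, we can apply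
Lemma 3.3 to get a function `φ_t` so that `φ_t⁴ ds²_t` is scalar flat and asymptotically flat.
Also, by (3.16), (3.22), and (3.23), the mass of `φ_t⁴ ds²_t` is
`M(t) = −(1/16π)·… ∫_N R_t φ_t √g_t dx`"*. Lemma 3.3 itself (pp. 71–72) sets `φ = 1 + v` with `v`
the Lemma 3.2 solution of `Δv − (R/8)v = R/8`, i.e. `Δφ = Rφ/8` with `φ = 1 + A/r + O₂(r⁻²)`,
and reads off positivity, scalar-flatness of `φ⁴ ds²` ((3.8)), the expansion (1.1) of `φ⁴ ds²`
and its mass `M + 2A`, `A = −(1/32π) ∫ Rφ dV` ((3.16)).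

This file **proves** the step `hc` of
`exists_ricciVariation_negativeMass_of_massZero_of_elliptic_steps` (`RicciVariationEllipticSteps.lean`)
— Lemma 3.3 along the family, with the constant `c₁ = 1/(16π)` and the uniqueness of the
conformal factor — from the bare **existence** of such a `φ_t` for `t` small (the output of
Lemma 3.2 applied to `ds²_t`), stated as the hypothesis `hsol` of
`lemma33_family_of_conformalFactor_exists`:

* positivity of `φ_t`: `φ_t → 1` along the only end, and `Δ_t φ_t = (R_t/8) φ_t` with
  `‖(R_t/8)₋‖_{L^{3/2}(dV_t)}` small for `t` small (`|R_t| ≤ |t| K (1 + ‖coord‖)⁻⁴`,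
  `exists_abs_scalarCurvature_ricciFamily_sub_le`; the uniform Sobolev constant of
  `exists_uniform_constants_ricciFamily`), so `pos_of_dalembertian_eq_mul`
  (`AFConformalPositivity.lean`) applies;
* `φ_t⁴ h_t` is scalar flat (`conformal_scalarCurvature_law`) and asymptotically
  Schwarzschildean of mass `2A_t` (`IsAsymptoticallySchwarzschild.conformal`, `h_t` having mass
  `0`, `isAsymptoticallySchwarzschild_of_metric_eq_add_ricci`), and `2A_t = −(1/16π) ∫ R_t φ_t dV_t`
  by the flux formula `∫ Δ_t φ_t dV_t = −4π A_t` (`AFEnd.integral_dalembertian_eq_of_expansion'`);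
* uniqueness: another positive `ψ` with `ψ⁴ h_t` scalar flat and asymptotically Schwarzschildean
  is smooth (`contMDiff_conformalFactor`), solves `Δ_t ψ = R_t ψ/8`
  (`dalembertian_conformalFactor_eq`), and `ψ − φ_t = O(1/r)`
  (`isBigO_endValue_sub_of_conformal`), so `ψ = φ_t` by `AFEnd.eq_zero_of_dalembertian_eq_mul`.

Consequently (`exists_ricciVariation_negativeMass_of_massZero_of_conformalFactor_exists`) the
named fact `exists_ricciVariation_negativeMass_of_massZero` follows from `hsol` alone. All results
are proved; no definitions, no named facts.

## References

* R. Schoen, S.-T. Yau, Comm. Math. Phys. 65 (1979) 45–76, Lemma 3.2 (p. 64), Lemma 3.3 and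
  (3.16), (3.22)–(3.23) (pp. 71–72), proof of Thm. 2 (p. 73).
-/

noncomputable section

open Set Function Filter Metric Bornology Asymptotics MeasureTheory Measure TopologicalSpace
  Manifold Bundle
open scoped Topology Manifold ContDiff ENNReal

namespace Literature.Geometry.Lorentzian

open Literature.Geometry.Riemannian PseudoRiemannianMetric

namespace AFEnd

variable {X : Type} [TopologicalSpace X] [ChartedSpace E3 X] [IsManifold (𝓡 3) ∞ X]
  [T2Space X] [SecondCountableTopology X] [LocallyCompactSpace X] [ConnectedSpace X]
  [MeasurableSpace X] [BorelSpace X]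
  (e : AFEnd X) (D : InitialDataSet (𝓡 3) X)

omit [T2Space X] [SecondCountableTopology X] [LocallyCompactSpace X] [ConnectedSpace X]
  [MeasurableSpace X] [BorelSpace X] in
/-- The scalar curvatures of the family are continuous. [folklore] -/
private theorem continuous_scalarCurvatureFn₃ (D₂ : InitialDataSet (𝓡 3) X) :
    Continuous D₂.scalarCurvatureFn := by
  haveI := D₂.metric.hasLeviCivita
  exact D₂.metric.contMDiff_scalarCurvature.continuous.congr fun x ↦ (D₂.scalarCurvatureFn_eq x).symm

omit [IsManifold (𝓡 3) ∞ X] [T2Space X] [SecondCountableTopology X] [LocallyCompactSpace X]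
  [ConnectedSpace X] [MeasurableSpace X] [BorelSpace X] in
/-- `φ → 1` along the end from the order-zero part of the expansion `φ = 1 + A/r + O(r⁻²)`.
[folklore] -/
private theorem tendstoAtEnd_one_of_expansion {φ : X → ℝ} {A : ℝ}
    (hexp : ∀ m : ℕ, m ≤ 2 →
      (fun x ↦ ‖iteratedFDeriv ℝ m (fun y ↦ endValue e φ y - (1 + A / ‖y‖)) x‖)
        =O[cobounded E3] fun x ↦ ‖x‖ ^ (-2 - m : ℝ)) :
    TendstoAtEnd e φ 1 := by
  have h0 := hexp 0 (Nat.zero_le _)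
  have hr : Tendsto (fun x : E3 ↦ ‖x‖ ^ (-2 - (0 : ℕ) : ℝ)) (cobounded E3) (𝓝 0) := by
    simp only [Nat.cast_zero, sub_zero]
    exact (tendsto_rpow_neg_atTop (by norm_num : (0 : ℝ) < 2)).comp tendsto_norm_cobounded_atTop
  have hdiff : Tendsto (fun y : E3 ↦ endValue e φ y - (1 + A / ‖y‖)) (cobounded E3) (𝓝 0) := by
    have h := h0.trans_tendsto hr
    rw [tendsto_zero_iff_norm_tendsto_zero]
    refine h.congr fun x ↦ ?_
    rw [norm_iteratedFDeriv_zero]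
  have hA : Tendsto (fun y : E3 ↦ 1 + A / ‖y‖) (cobounded E3) (𝓝 (1 + 0)) :=
    tendsto_const_nhds.add ((tendsto_const_nhds (x := A)).div_atTop tendsto_norm_cobounded_atTop)
  rw [add_zero] at hA
  have := hdiff.add hA
  simp only [zero_add, sub_add_cancel] at this
  exact this

set_option maxHeartbeats 1600000 in
-- a long assembly
/-- **Lemma 3.3 for one member of the family, from the existence of its conformal factor.** Fix
`|t| < τ'` small (within the uniform constants). If `φ` is smooth with `Δ_t φ = R_t φ/8` and
`φ = 1 + A/r + O₂(r⁻²)` in the chart of the end, then: `φ > 0`; `φ⁴ h_t` (the data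
`(D_t).conformal φ`) is scalar flat; `R_t φ ∈ L¹(dV_t)`; `φ⁴ h_t` is asymptotically
Schwarzschildean of mass `−(1/16π) ∫ R_t φ dV_t`; and `φ` is the unique positive factor with
`ψ⁴ h_t` scalar flat and asymptotically Schwarzschildean. [cite: SchoenYauPMT1979, Lemma 3.3 (pp. 71–72) and p. 73] -/
theorem lemma33_familyMember [D.metric.HasLeviCivita]
    (haf : e.IsStronglyAsymptoticallyFlatWith D 0 2 0 5 0) (hsole : e.IsSoleEnd)
    (hR0 : ∀ x : X, D.metric.scalarCurvature x = 0) {τ : ℝ} (hτ : 0 < τ)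
    (Dt : ℝ → InitialDataSet (𝓡 3) X)
    (hval : ∀ t : ℝ, |t| < τ → ∀ (x : X) (v w : TangentSpace (𝓡 3) x),
      (Dt t).metric.val x v w = D.metric.val x v w + t * D.metric.ricci x v w) :
    ∃ τ₆ : ℝ, 0 < τ₆ ∧ τ₆ ≤ τ ∧ ∀ t : ℝ, |t| < τ₆ → ∀ (φ : X → ℝ) (A : ℝ)
      (hφs : ContMDiff (𝓡 3) 𝓘(ℝ) ∞ φ),
      (∀ x, haveI := (Dt t).metric.hasLeviCivita
        (Dt t).metric.dalembertian φ x = (Dt t).scalarCurvatureFn x * φ x / 8) →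
      (∀ m : ℕ, m ≤ 2 →
        (fun x ↦ ‖iteratedFDeriv ℝ m (fun y ↦ endValue e φ y - (1 + A / ‖y‖)) x‖)
          =O[cobounded E3] fun x ↦ ‖x‖ ^ (-2 - m : ℝ)) →
      ∃ hpos : ∀ x, 0 < φ x,
        (∀ x, ((Dt t).conformal φ hφs hpos).scalarCurvatureFn x = 0) ∧
        Integrable (fun x ↦ (Dt t).scalarCurvatureFn x * φ x) (riemannianMeasure (Dt t).h) ∧
        IsAsymptoticallySchwarzschild e ((Dt t).conformal φ hφs hpos)
          (-(16 * Real.pi)⁻¹ * ∫ x, (Dt t).scalarCurvatureFn x * φ x ∂riemannianMeasure (Dt t).h) 2 ∧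
        (∀ (ψ : X → ℝ) (D'' : InitialDataSet (𝓡 3) X) (m : ℝ),
          (∀ x : X, 0 < ψ x) →
          (∀ (x : X) (v w : TangentSpace (𝓡 3) x),
            D''.metric.val x v w = ψ x ^ 4 * (Dt t).metric.val x v w) →
          (∀ x : X, D''.scalarCurvatureFn x = 0) →
          IsAsymptoticallySchwarzschild e D'' m 2 → ψ = φ) := by
  set μ : Measure X := riemannianMeasure D.h with hμ
  -- uniform constants and the global curvature bound
  obtain ⟨τ₁, C, c₁, hτ₁, hτ₁τ, hC0, -, hc₁, -, hunif⟩ :=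
    e.exists_uniform_constants_ricciFamily D haf hsole hτ Dt hval
  obtain ⟨τ₂, K, hτ₂, hτ₂τ, hK0, hglob⟩ :=
    e.exists_abs_scalarCurvature_ricciFamily_sub_le D haf hsole hτ Dt hval
  have hAF : e.IsMetricAsymptoticallyFlat D 2 :=
    AFEnd.IsStronglyAsymptoticallyFlatWith.isMetricAsymptoticallyFlat_of_massZero e D haf
      (by norm_num)
  set J₂ : ℝ := ∫ x, (1 + ‖e.coord x‖) ^ (-(4 * (3 / 2 : ℝ))) ∂μ with hJ₂
  have hJ₂0 : 0 ≤ J₂ := integral_nonneg fun x ↦ Real.rpow_nonneg (by positivity) _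
  clear_value J₂
  set A₀ : ℝ := c₁ * (K / 8) * (2 * J₂) ^ (2 / 3 : ℝ) with hA₀
  have hA₀0 : 0 ≤ A₀ := by positivity
  set τ₆ : ℝ := min (min τ₁ τ₂) (1 / (2 * (A₀ + 1))) with hτ₆
  have hτ₆0 : 0 < τ₆ := lt_min (lt_min hτ₁ hτ₂) (by positivity)
  refine ⟨τ₆, hτ₆0, ((min_le_left _ _).trans (min_le_left _ _)).trans hτ₁τ,
    fun t ht φ A hφs hpde hexp ↦ ?_⟩
  have ht₁ : |t| < τ₁ := ht.trans_le ((min_le_left _ _).trans (min_le_left _ _))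
  have ht₂ : |t| < τ₂ := ht.trans_le ((min_le_left _ _).trans (min_le_right _ _))
  have htτ : |t| < τ := ht₁.trans_le hτ₁τ
  have htA : A₀ * |t| ≤ 1 / 2 := by
    have h1 : |t| ≤ 1 / (2 * (A₀ + 1)) := ht.le.trans (min_le_right _ _)
    have h2 : A₀ * |t| ≤ A₀ * (1 / (2 * (A₀ + 1))) := mul_le_mul_of_nonneg_left h1 hA₀0
    have h3 : A₀ * (1 / (2 * (A₀ + 1))) ≤ 1 / 2 := by
      rw [mul_one_div, div_le_iff₀ (by positivity)]
      linarith
    exact h2.trans h3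
  obtain ⟨-, -, -, hμle, -, hS⟩ := hunif t ht₁
  haveI := (Dt t).metric.hasLeviCivita
  have hASt : IsAsymptoticallySchwarzschild e (Dt t) 0 2 :=
    e.isAsymptoticallySchwarzschild_of_metric_eq_add_ricci D haf (hval t htτ)
  have hAFt : e.IsMetricAsymptoticallyFlat (Dt t) 2 := hASt.isMetricAsymptoticallyFlat_two le_rfl
  set μt : Measure X := riemannianMeasure (Dt t).h with hμt
  set R : X → ℝ := (Dt t).scalarCurvatureFn with hR
  have hRc : Continuous R := continuous_scalarCurvatureFn₃ (Dt t)
  -- `|R_t| ≤ |t| K W`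
  have hR00 : D.scalarCurvatureFn = fun _ ↦ 0 := by
    funext x
    rw [D.scalarCurvatureFn_eq]
    exact hR0 x
  have hRle : ∀ x, |R x| ≤ |t| * K * (1 + ‖e.coord x‖) ^ (-4 : ℝ) := fun x ↦ by
    have h := hglob t ht₂ x
    rw [hR00, sub_zero] at h
    exact h
  -- the potential `c = R/8`, its negative part in `L^{3/2}(dV_t)` and the smallness
  set c : X → ℝ := fun x ↦ R x / 8 with hc
  have hcc : Continuous c := hRc.div_const 8
  have hW32 : Integrable (fun x ↦ (1 + ‖e.coord x‖) ^ (-(4 * (3 / 2 : ℝ)))) μt :=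
    e.integrable_one_add_norm_coord_rpow_neg_of_le D two_pos hAF hsole (by norm_num) hμle
  have hcm0 : ∀ x, 0 ≤ max (-c x) 0 := fun x ↦ le_max_right _ _
  have hcmle : ∀ x, max (-c x) 0 ^ (3 / 2 : ℝ) ≤
      (|t| * K * 8⁻¹) ^ (3 / 2 : ℝ) * (1 + ‖e.coord x‖) ^ (-(4 * (3 / 2 : ℝ))) := fun x ↦ by
    have h1 : max (-c x) 0 ≤ |t| * K * 8⁻¹ * (1 + ‖e.coord x‖) ^ (-4 : ℝ) := by
      refine max_le ?_ (by positivity)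
      have := hRle x
      have h' : -c x ≤ |R x| / 8 := by
        simp only [hc]
        have := neg_abs_le (R x)
        linarith
      refine h'.trans ?_
      rw [div_eq_mul_inv]
      nlinarith [Real.rpow_nonneg (by positivity : (0 : ℝ) ≤ 1 + ‖e.coord x‖) (-4 : ℝ)]
    calc max (-c x) 0 ^ (3 / 2 : ℝ) ≤ (|t| * K * 8⁻¹ * (1 + ‖e.coord x‖) ^ (-4 : ℝ)) ^ (3 / 2 : ℝ) :=
          Real.rpow_le_rpow (hcm0 x) h1 (by norm_num)
      _ = (|t| * K * 8⁻¹) ^ (3 / 2 : ℝ) * (1 + ‖e.coord x‖) ^ (-(4 * (3 / 2 : ℝ))) := by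
          rw [Real.mul_rpow (by positivity) (Real.rpow_nonneg (by positivity) _),
            ← Real.rpow_mul (by positivity)]
          norm_num
  have hci : Integrable (fun x ↦ max (-c x) 0 ^ (3 / 2 : ℝ)) μt := by
    refine (hW32.const_mul ((|t| * K * 8⁻¹) ^ (3 / 2 : ℝ))).mono'
      ((hcc.neg.max continuous_const).rpow_const fun x ↦ Or.inr (by norm_num)).aestronglyMeasurable
      (Eventually.of_forall fun x ↦ ?_)
    rw [Real.norm_of_nonneg (Real.rpow_nonneg (hcm0 x) _)]
    exact hcmle x
  have hNle : ∫ x, max (-c x) 0 ^ (3 / 2 : ℝ) ∂μt ≤ (|t| * K * 8⁻¹) ^ (3 / 2 : ℝ) * (2 * J₂) := by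
    have hWμ : Integrable (fun x ↦ (1 + ‖e.coord x‖) ^ (-(4 * (3 / 2 : ℝ)))) μ :=
      e.integrable_one_add_norm_coord_rpow_neg D two_pos hAF hsole (by norm_num)
    have hle2 : ∫ x, (1 + ‖e.coord x‖) ^ (-(4 * (3 / 2 : ℝ))) ∂μt ≤ 2 * J₂ := by
      calc ∫ x, (1 + ‖e.coord x‖) ^ (-(4 * (3 / 2 : ℝ))) ∂μt
          ≤ ∫ x, (1 + ‖e.coord x‖) ^ (-(4 * (3 / 2 : ℝ))) ∂(ENNReal.ofReal 2 • μ) :=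
            integral_mono_measure hμle (Eventually.of_forall fun x ↦ Real.rpow_nonneg (by positivity) _)
              (hWμ.smul_measure ENNReal.ofReal_ne_top)
        _ = 2 * J₂ := by
            rw [integral_smul_measure, ENNReal.toReal_ofReal (by norm_num : (0 : ℝ) ≤ 2), smul_eq_mul, hJ₂]
    calc ∫ x, max (-c x) 0 ^ (3 / 2 : ℝ) ∂μt
        ≤ ∫ x, (|t| * K * 8⁻¹) ^ (3 / 2 : ℝ) * (1 + ‖e.coord x‖) ^ (-(4 * (3 / 2 : ℝ))) ∂μt :=
          integral_mono hci (hW32.const_mul _) hcmle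
      _ = (|t| * K * 8⁻¹) ^ (3 / 2 : ℝ) * ∫ x, (1 + ‖e.coord x‖) ^ (-(4 * (3 / 2 : ℝ))) ∂μt :=
          integral_const_mul _ _
      _ ≤ (|t| * K * 8⁻¹) ^ (3 / 2 : ℝ) * (2 * J₂) :=
          mul_le_mul_of_nonneg_left hle2 (Real.rpow_nonneg (by positivity) _)
  have hN0 : 0 ≤ ∫ x, max (-c x) 0 ^ (3 / 2 : ℝ) ∂μt := integral_nonneg fun x ↦ Real.rpow_nonneg (hcm0 x) _
  have hθle : c₁ * (∫ x, max (-c x) 0 ^ (3 / 2 : ℝ) ∂μt) ^ (2 / 3 : ℝ) ≤ 1 / 2 := by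
    have h1 : (∫ x, max (-c x) 0 ^ (3 / 2 : ℝ) ∂μt) ^ (2 / 3 : ℝ) ≤
        ((|t| * K * 8⁻¹) ^ (3 / 2 : ℝ) * (2 * J₂)) ^ (2 / 3 : ℝ) := Real.rpow_le_rpow hN0 hNle (by norm_num)
    have h2 : ((|t| * K * 8⁻¹) ^ (3 / 2 : ℝ) * (2 * J₂)) ^ (2 / 3 : ℝ) = |t| * K * 8⁻¹ * (2 * J₂) ^ (2 / 3 : ℝ) := by
      rw [Real.mul_rpow (Real.rpow_nonneg (by positivity) _) (by positivity),
        ← Real.rpow_mul (by positivity)]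
      norm_num
    rw [h2] at h1
    calc c₁ * (∫ x, max (-c x) 0 ^ (3 / 2 : ℝ) ∂μt) ^ (2 / 3 : ℝ)
        ≤ c₁ * (|t| * K * 8⁻¹ * (2 * J₂) ^ (2 / 3 : ℝ)) := mul_le_mul_of_nonneg_left h1 hc₁
      _ = A₀ * |t| := by simp only [hA₀]; ring
      _ ≤ 1 / 2 := htA
  have hθ1 : c₁ * (∫ x, max (-c x) 0 ^ (3 / 2 : ℝ) ∂μt) ^ (2 / 3 : ℝ) < 1 := hθle.trans_lt (by norm_num)
  have hθ3 : 4 * c₁ * (∫ x, max (-c x) 0 ^ (3 / 2 : ℝ) ∂μt) ^ (2 / 3 : ℝ) < 3 := by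
    have : 4 * c₁ * (∫ x, max (-c x) 0 ^ (3 / 2 : ℝ) ∂μt) ^ (2 / 3 : ℝ) =
        4 * (c₁ * (∫ x, max (-c x) 0 ^ (3 / 2 : ℝ) ∂μt) ^ (2 / 3 : ℝ)) := by ring
    rw [this]
    linarith
  -- the factor: smoothness, the equation `Δ_t φ = c φ`, `φ → 1`
  have hφ2 : ContMDiff (𝓡 3) 𝓘(ℝ, ℝ) 2 φ := hφs.of_le (WithTop.coe_le_coe.2 le_top)
  have hφc : Continuous φ := hφs.continuous
  have hpde' : ∀ x, (Dt t).metric.dalembertian φ x = c x * φ x := fun x ↦ by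
    rw [hpde x]
    simp only [hc, hR]
    ring
  have hlim : TendstoAtEnd e φ 1 := e.tendstoAtEnd_one_of_expansion hexp
  -- (1) positivity
  have hpos : ∀ x, 0 < φ x := by
    have hev : ∀ᶠ y in cobounded E3, 1 / 2 < endValue e φ y :=
      (Metric.tendsto_nhds.1 hlim) (1 / 2) (by norm_num) |>.mono fun y hy ↦ by
        rw [Real.dist_eq, abs_lt] at hy
        linarith
    obtain ⟨R₀, -, hR₀⟩ := (hasBasis_cobounded_norm (E := E3)).eventually_iff.1 hev
    have hfar : ∀ q ∈ e.far (max R₀ e.R), 0 < φ q := by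
      intro q hq
      obtain ⟨z, hz, rfl⟩ := e.mem_far_iff.1 hq
      have h1 := hR₀ (show (z : E3) ∈ {x | R₀ ≤ ‖x‖} from (le_max_left _ _).trans hz.le)
      rw [endValue_of_lt e φ z.2] at h1
      have h2 : φ (e.dataChart z) = φ (e.dataChart ⟨z, z.2⟩) := rfl
      rw [h2]
      linarith
    obtain ⟨Kc, hKc, hcover⟩ := hsole.exists_isCompact_cover (max R₀ e.R)
    have hne : Kcᶜ.Nonempty := by
      by_contra h
      rw [not_nonempty_iff_eq_empty, compl_empty_iff] at h
      exact e.not_isCompact_univ (h ▸ hKc)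
    refine pos_of_dalembertian_eq_mul (Dt t) hS hcc hci hθ3 hφ2 hpde' hKc (fun x hx ↦ ?_) hne
    rcases hcover x with h | h
    · exact absurd h hx
    · exact hfar x h
  refine ⟨hpos, ?_, ?_, ?_, ?_⟩
  -- (2) scalar flatness of `φ⁴ h_t`
  · intro x
    set D' := (Dt t).conformal φ hφs hpos with hD'
    haveI := D'.metric.hasLeviCivita
    have hlaw := conformal_scalarCurvature_law X (Dt t).metric D'.metric φ (Dt t).isRiemannian_metric
      hφs hpos (fun x v w ↦ (Dt t).metric_conformal_val φ hφs hpos x v w) x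
    rw [D'.scalarCurvatureFn_eq, hlaw, ← (Dt t).scalarCurvatureFn_eq, hpde x]
    ring
  -- (3) integrability of `R_t φ`
  · obtain ⟨Cφ, hCφ⟩ := AFEnd.exists_bound_of_tendstoAtEnd hsole hφc hlim
    have hCφ0 : 0 ≤ Cφ := (abs_nonneg _).trans (hCφ (Classical.arbitrary X))
    have hW : Integrable (fun x ↦ (1 + ‖e.coord x‖) ^ (-4 : ℝ)) μt :=
      e.integrable_one_add_norm_coord_rpow_neg_of_le D two_pos hAF hsole (by norm_num) hμle
    refine (hW.const_mul (|t| * K * Cφ)).mono' (hRc.mul hφc).aestronglyMeasurable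
      (Eventually.of_forall fun x ↦ ?_)
    rw [Real.norm_eq_abs, abs_mul]
    calc |R x| * |φ x| ≤ |t| * K * (1 + ‖e.coord x‖) ^ (-4 : ℝ) * Cφ :=
          mul_le_mul (hRle x) (hCφ x) (abs_nonneg _) (by positivity)
      _ = |t| * K * Cφ * (1 + ‖e.coord x‖) ^ (-4 : ℝ) := by ring
  -- (4) the mass: `φ⁴ h_t` is asymptotically Schwarzschildean of mass `2A = -(1/16π) ∫ R φ`
  · have hmass : IsAsymptoticallySchwarzschild e ((Dt t).conformal φ hφs hpos) (0 + 2 * A) 2 :=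
      hASt.conformal hφs hpos hexp
    -- the flux formula
    have hint : Integrable (fun x ↦ (Dt t).scalarCurvatureFn x * φ x) μt := by
      obtain ⟨Cφ, hCφ⟩ := AFEnd.exists_bound_of_tendstoAtEnd hsole hφc hlim
      have hW : Integrable (fun x ↦ (1 + ‖e.coord x‖) ^ (-4 : ℝ)) μt :=
        e.integrable_one_add_norm_coord_rpow_neg_of_le D two_pos hAF hsole (by norm_num) hμle
      refine (hW.const_mul (|t| * K * Cφ)).mono' (hRc.mul hφc).aestronglyMeasurable
        (Eventually.of_forall fun x ↦ ?_)
      rw [Real.norm_eq_abs, abs_mul]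
      calc |R x| * |φ x| ≤ |t| * K * (1 + ‖e.coord x‖) ^ (-4 : ℝ) * Cφ :=
            mul_le_mul (hRle x) (hCφ x) (abs_nonneg _) (by positivity)
        _ = |t| * K * Cφ * (1 + ‖e.coord x‖) ^ (-4 : ℝ) := by ring
    have hΔint : Integrable ((Dt t).metric.dalembertian φ) μt :=
      (hint.div_const 8).congr (Eventually.of_forall fun x ↦ (hpde x).symm)
    have hflux := e.integral_dalembertian_eq_of_expansion' (Dt t) two_pos hAFt hsole hφ2 hΔint hexp
    have h8 : ∫ x, (Dt t).metric.dalembertian φ x ∂μt =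
        (∫ x, (Dt t).scalarCurvatureFn x * φ x ∂μt) / 8 := by
      rw [← integral_div]
      exact integral_congr_ae (Eventually.of_forall fun x ↦ hpde x)
    rw [h8] at hflux
    have hA : 0 + 2 * A = -(16 * Real.pi)⁻¹ * ∫ x, (Dt t).scalarCurvatureFn x * φ x ∂μt := by
      have hπ : Real.pi ≠ 0 := Real.pi_ne_zero
      field_simp
      linarith
    rw [hA] at hmass
    exact hmass
  -- (5) uniqueness
  · intro ψ D'' m hψpos hψconf hψflat hψAS
    have hψs : ContMDiff (𝓡 3) 𝓘(ℝ, ℝ) ∞ ψ :=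
      contMDiff_conformalFactor (Dt t).metric D''.metric (Dt t).isRiemannian_metric hψpos hψconf
    have hψ2 : ContMDiff (𝓡 3) 𝓘(ℝ, ℝ) 2 ψ := hψs.of_le (WithTop.coe_le_coe.2 le_top)
    have hΔψ : ∀ x, (Dt t).metric.dalembertian ψ x = (Dt t).scalarCurvatureFn x * ψ x / 8 :=
      (Dt t).dalembertian_conformalFactor_eq D'' hψpos hψconf hψflat
    have hmassφ : IsAsymptoticallySchwarzschild e ((Dt t).conformal φ hφs hpos) (0 + 2 * A) 2 :=
      hASt.conformal hφs hpos hexp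
    -- `w = ψ − φ` solves `Δ_t w = c w` and is `O(1/r)`
    have hw2 : ContMDiff (𝓡 3) 𝓘(ℝ, ℝ) 2 (ψ - φ) := hψ2.sub hφ2
    have hpdew : ∀ x, (Dt t).metric.dalembertian (ψ - φ) x = c x * (ψ - φ) x := fun x ↦ by
      rw [dalembertian_sub (Dt t).metric (hψ2 x) (hφ2 x), hΔψ x, hpde x, Pi.sub_apply]
      simp only [hc, hR]
      ring
    have hdecw : endValue e (ψ - φ) =O[cobounded E3] fun z ↦ ‖z‖⁻¹ :=
      e.isBigO_endValue_sub_of_conformal hASt hψAS hmassφ hψpos hpos hψconf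
        (fun x v w ↦ (Dt t).metric_conformal_val φ hφs hpos x v w)
    have hw0 := e.eq_zero_of_dalembertian_eq_mul (Dt t) two_pos hAFt hsole hS hcc hci hθ1 hw2 hpdew hdecw
    funext x
    have := congrFun hw0 x
    simp only [Pi.sub_apply, Pi.zero_apply] at this
    linarith

end AFEnd

/-- **Step `hc` from the existence of the conformal factors along the family** (Schoen–Yau 1979,
Lemma 3.3 applied to `ds²_t`, p. 73, with (3.16), (3.22)–(3.23)): if for all admissible
`(X, D, e)` (oriented, `h − δ = o₅(r⁻²)` on the only end, `R ≡ 0`) and every family `D_t` with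
metric `h + t Ric` on `|t| < τ` there is `τ₀ ∈ (0, τ]` such that for `|t| < τ₀` some smooth `φ`
solves `Δ_t φ = R_t φ / 8` with `φ = 1 + A/r + O₂(r⁻²)` (the output of Lemma 3.2 for
`v = φ − 1`), then the hypothesis `hc` of
`exists_ricciVariation_negativeMass_of_massZero_of_elliptic_steps` holds with `c₁ = 1/(16π)`
(`AFEnd.lemma33_familyMember`). [cite: SchoenYauPMT1979, Lemma 3.3 (pp. 71–72) and p. 73] -/
theorem lemma33_family_of_conformalFactor_exists
    (hsol : ∀ (X : Type) [TopologicalSpace X] [ChartedSpace E3 X] [IsManifold (𝓡 3) ∞ X]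
      [T2Space X] [SecondCountableTopology X] [LocallyCompactSpace X] [ConnectedSpace X]
      [MeasurableSpace X] [BorelSpace X]
      (D : InitialDataSet (𝓡 3) X) [D.metric.HasLeviCivita] (e : AFEnd X) (τ : ℝ)
      (Dt : ℝ → InitialDataSet (𝓡 3) X),
      Literature.Topology.FourManifolds.IsOrientable (𝓡 3) X →
      e.IsStronglyAsymptoticallyFlatWith D 0 2 0 5 0 → e.IsSoleEnd →
      (∀ x : X, D.metric.scalarCurvature x = 0) → 0 < τ →
      (∀ t : ℝ, |t| < τ → ∀ (x : X) (v w : TangentSpace (𝓡 3) x),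
        (Dt t).metric.val x v w = D.metric.val x v w + t * D.metric.ricci x v w) →
      ∃ τ₀ : ℝ, 0 < τ₀ ∧ τ₀ ≤ τ ∧ ∀ t : ℝ, |t| < τ₀ →
        ∃ (φ : X → ℝ) (A : ℝ), ContMDiff (𝓡 3) 𝓘(ℝ) ∞ φ ∧
          (∀ x, haveI := (Dt t).metric.hasLeviCivita
            (Dt t).metric.dalembertian φ x = (Dt t).scalarCurvatureFn x * φ x / 8) ∧
          ∀ m : ℕ, m ≤ 2 →
            (fun x ↦ ‖iteratedFDeriv ℝ m (fun y ↦ endValue e φ y - (1 + A / ‖y‖)) x‖)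
              =O[cobounded E3] fun x ↦ ‖x‖ ^ (-2 - m : ℝ)) :
    ∃ c₁ : ℝ, 0 < c₁ ∧
      ∀ (X : Type) [TopologicalSpace X] [ChartedSpace E3 X] [IsManifold (𝓡 3) ∞ X] [T2Space X]
        [SecondCountableTopology X] [LocallyCompactSpace X] [ConnectedSpace X]
        [MeasurableSpace X] [BorelSpace X]
        (D : InitialDataSet (𝓡 3) X) [D.metric.HasLeviCivita] (e : AFEnd X) (τ : ℝ)
        (Dt : ℝ → InitialDataSet (𝓡 3) X),
        Literature.Topology.FourManifolds.IsOrientable (𝓡 3) X →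
        e.IsStronglyAsymptoticallyFlatWith D 0 2 0 5 0 → e.IsSoleEnd →
        (∀ x : X, D.metric.scalarCurvature x = 0) → 0 < τ →
        (∀ t : ℝ, |t| < τ → ∀ (x : X) (v w : TangentSpace (𝓡 3) x),
          (Dt t).metric.val x v w = D.metric.val x v w + t * D.metric.ricci x v w) →
        ∃ (τ' : ℝ) (φ : ℝ → X → ℝ) (D' : ℝ → InitialDataSet (𝓡 3) X), 0 < τ' ∧ τ' ≤ τ ∧
          ∀ t : ℝ, |t| < τ' →
            (∀ x : X, 0 < φ t x) ∧
            (∀ (x : X) (v w : TangentSpace (𝓡 3) x),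
              (D' t).metric.val x v w = φ t x ^ 4 * (Dt t).metric.val x v w) ∧
            (∀ x : X, (D' t).scalarCurvatureFn x = 0) ∧
            Integrable (fun x ↦ (Dt t).scalarCurvatureFn x * φ t x) (riemannianMeasure (Dt t).h) ∧
            IsAsymptoticallySchwarzschild e (D' t)
              (-c₁ * ∫ x, (Dt t).scalarCurvatureFn x * φ t x ∂(riemannianMeasure (Dt t).h)) 2 ∧
            (∀ (ψ : X → ℝ) (D'' : InitialDataSet (𝓡 3) X) (m : ℝ),
              (∀ x : X, 0 < ψ x) →
              (∀ (x : X) (v w : TangentSpace (𝓡 3) x),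
                D''.metric.val x v w = ψ x ^ 4 * (Dt t).metric.val x v w) →
              (∀ x : X, D''.scalarCurvatureFn x = 0) →
              IsAsymptoticallySchwarzschild e D'' m 2 → ψ = φ t) := by
  classical
  refine ⟨(16 * Real.pi)⁻¹, by positivity, ?_⟩
  intro X _ _ _ _ _ _ _ _ _ D _ e τ Dt hor haf hsole hR0 hτ hval
  obtain ⟨τ₀, hτ₀, hτ₀τ, hex⟩ := hsol X D e τ Dt hor haf hsole hR0 hτ hval
  obtain ⟨τ₆, hτ₆, hτ₆τ, hmem⟩ := e.lemma33_familyMember D haf hsole hR0 hτ Dt hval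
  set τ' : ℝ := min τ₀ τ₆ with hτ'
  -- the per-`t` package
  have key : ∀ t : ℝ, |t| < τ' → ∃ (φ : X → ℝ) (D' : InitialDataSet (𝓡 3) X),
      (∀ x : X, 0 < φ x) ∧
      (∀ (x : X) (v w : TangentSpace (𝓡 3) x), D'.metric.val x v w = φ x ^ 4 * (Dt t).metric.val x v w) ∧
      (∀ x : X, D'.scalarCurvatureFn x = 0) ∧
      Integrable (fun x ↦ (Dt t).scalarCurvatureFn x * φ x) (riemannianMeasure (Dt t).h) ∧
      IsAsymptoticallySchwarzschild e D'
        (-(16 * Real.pi)⁻¹ * ∫ x, (Dt t).scalarCurvatureFn x * φ x ∂(riemannianMeasure (Dt t).h)) 2 ∧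
      (∀ (ψ : X → ℝ) (D'' : InitialDataSet (𝓡 3) X) (m : ℝ),
        (∀ x : X, 0 < ψ x) →
        (∀ (x : X) (v w : TangentSpace (𝓡 3) x),
          D''.metric.val x v w = ψ x ^ 4 * (Dt t).metric.val x v w) →
        (∀ x : X, D''.scalarCurvatureFn x = 0) →
        IsAsymptoticallySchwarzschild e D'' m 2 → ψ = φ) := by
    intro t ht
    obtain ⟨φ, A, hφs, hpde, hexp⟩ := hex t (ht.trans_le (min_le_left _ _))
    obtain ⟨hpos, hflat, hint, hmass, huniq⟩ :=
      hmem t (ht.trans_le (min_le_right _ _)) φ A hφs hpde hexp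
    exact ⟨φ, (Dt t).conformal φ hφs hpos, hpos,
      fun x v w ↦ (Dt t).metric_conformal_val φ hφs hpos x v w, hflat, hint, hmass, huniq⟩
  refine ⟨τ', fun t ↦ if h : |t| < τ' then Classical.choose (key t h) else fun _ ↦ 1,
    fun t ↦ if h : |t| < τ' then Classical.choose (Classical.choose_spec (key t h)) else Dt t,
    lt_min hτ₀ hτ₆, (min_le_left _ _).trans hτ₀τ, fun t ht ↦ ?_⟩
  simp only [dif_pos ht]
  exact Classical.choose_spec (Classical.choose_spec (key t ht))

/-- **`Ric ≡ 0` (step 2 of positive mass rigidity) from Lemma 3.2 along the family.** The named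
fact `exists_ricciVariation_negativeMass_of_massZero` (Schoen–Yau 1979, proof of Thm. 2,
pp. 72–74) follows from the existence, for `t` small, of the conformal factors `φ_t` of Lemma 3.3
for `ds²_t = ds² + t Ric` (`Δ_t φ_t = R_t φ_t/8`, `φ_t = 1 + A_t/r + O₂(r⁻²)`, i.e. the Lemma 3.2
solution `v_t = φ_t − 1`): everything else — the family (`exists_ricciFamily`),
`R'₀ = −‖Ric‖²` (`hasDerivAt_scalarCurvatureFn_ricciVariation`), Lemma 3.3's conclusions and
uniqueness (`lemma33_family_of_conformalFactor_exists`), and the differentiation of the mass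
(`ricciVariation_massIntegral_hasDerivAt`) — is proved in this tree.
[cite: SchoenYauPMT1979, §3, proof of Thm. 2 (pp. 72–74)] -/
theorem exists_ricciVariation_negativeMass_of_massZero_of_conformalFactor_exists
    (hsol : ∀ (X : Type) [TopologicalSpace X] [ChartedSpace E3 X] [IsManifold (𝓡 3) ∞ X]
      [T2Space X] [SecondCountableTopology X] [LocallyCompactSpace X] [ConnectedSpace X]
      [MeasurableSpace X] [BorelSpace X]
      (D : InitialDataSet (𝓡 3) X) [D.metric.HasLeviCivita] (e : AFEnd X) (τ : ℝ)
      (Dt : ℝ → InitialDataSet (𝓡 3) X),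
      Literature.Topology.FourManifolds.IsOrientable (𝓡 3) X →
      e.IsStronglyAsymptoticallyFlatWith D 0 2 0 5 0 → e.IsSoleEnd →
      (∀ x : X, D.metric.scalarCurvature x = 0) → 0 < τ →
      (∀ t : ℝ, |t| < τ → ∀ (x : X) (v w : TangentSpace (𝓡 3) x),
        (Dt t).metric.val x v w = D.metric.val x v w + t * D.metric.ricci x v w) →
      ∃ τ₀ : ℝ, 0 < τ₀ ∧ τ₀ ≤ τ ∧ ∀ t : ℝ, |t| < τ₀ →
        ∃ (φ : X → ℝ) (A : ℝ), ContMDiff (𝓡 3) 𝓘(ℝ) ∞ φ ∧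
          (∀ x, haveI := (Dt t).metric.hasLeviCivita
            (Dt t).metric.dalembertian φ x = (Dt t).scalarCurvatureFn x * φ x / 8) ∧
          ∀ m : ℕ, m ≤ 2 →
            (fun x ↦ ‖iteratedFDeriv ℝ m (fun y ↦ endValue e φ y - (1 + A / ‖y‖)) x‖)
              =O[cobounded E3] fun x ↦ ‖x‖ ^ (-2 - m : ℝ)) :
    exists_ricciVariation_negativeMass_of_massZero :=
  exists_ricciVariation_negativeMass_of_massZero_of_lemma33_family
    (lemma33_family_of_conformalFactor_exists hsol)

end Literature.Geometry.Lorentzian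

end
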